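import Summits.ResolutionOfSingularities.ResolutionOfSingularities.Theorems.HomologicalConductorNoZenoE3CoarseningSplit
import Summits.ResolutionOfSingularities.ResolutionOfSingularities.Theorems.HomologicalConductorNoZenoTraceSocleCurveConfined
import HarnessLib

/-!
# Crux `NoZenoR` (stmt-ResolutionOfSingularities-19943), slot 3 `stub_noCaZenoChainSharpF`, tr.deg-3 half `E3`:
# THE CURVE-COARSENING HABITAT IS CLOSED — `E3` REDUCES TO THE PRIME-DIVISOR HABITAT

OURS (cell res-hironaka, crux chain W4.4; lead res-L0-w44-lead-1 g10, OBJECT 3-U, follow-up of 3-T `…NoZenoE3CoarseningSplit`).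
AI-written, weaker than expert review; nothing here is a statement of the manuscript under review (Hironaka 2017).  SUPPORT-level,
counted 0.  Def-free, fact-free.

By the arithmetic of 3-T (`coarsening_dvr_or_residueTrdeg_eq_one`) a proper coarsening `O < O₁ ≠ K` in transcendence degree `3` is a
prime divisor (`F = 2`, a DVR) or has `F = 1`.  The second habitat is CLOSED by the tree's THEOREM A₂ of the trace-socle layer
(`TraceSocle.curveCoarsening_terminates`, ideator res-L0-w44-idea-1 / stub-1 p543974: a threadless tower with radical persistence and
StrictDrop, escaping into a coarsening of residual transcendence degree `≤ 1`, TERMINATES — any rank, no discreteness).  Hence: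

* `e3Conclusion_of_curveCoarsening` — E3's conclusion whenever some proper coarsening has `residueTrdeg ≤ 1`;
* TEXT LEVEL `noCaZenoChainSharp3_of_primeDivisorSplit : <E3^{pd}> → <E3>`, where `E3^{pd}` := the `E3` text with the ground-field binder
  NAMED and, after the coarsening binder, (nd) NON-DISCRETE SOCLE (as in 3-T) and (pd) «EVERY proper coarsening `O₁ ≠ K` is a PRIME DIVISOR:
  a discrete valuation ring with `residueTrdeg k O₁ = 2`».  OUTCOME: slot-3 residual of record = {H, E3^{pd}} — «`O = O_E ∘ Ō` on a
  threefold, `E` a PRIME DIVISOR, `Ō` a rank-one NON-DISCRETE zero-dimensional valuation of the SURFACE field `κ(E)`; exhausting,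
  threadless ⊢ no `ca`-Zeno chain in the `E`-units» — a kernel SURFACE datum one dimension down riding under the threefold's tower.

References: O. Zariski, P. Samuel, *Commutative Algebra* II (1960), Ch. VI §14, Thm. 31 [`ZariskiSamuel1960`]; OURS: idea-1 card 10
`trace-socle` (THM A₂), tree `…NoZenoTraceSocleCurveConfined`.
-/

noncomputable section

-- single-problem summit: the doubled namespace component `ResolutionOfSingularities` is forced
set_option linter.dupNamespace false

namespace Summit.ResolutionOfSingularities.ResolutionOfSingularities.Theorems.NoZeno.CompositeSplit

open Summit.ResolutionOfSingularities.ResolutionOfSingularities.Theses.HomologicalConductor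
open Summit.ResolutionOfSingularities.ResolutionOfSingularities.Theorems.NoZeno.Birth
open Summit.ResolutionOfSingularities.ResolutionOfSingularities.Theorems.NoZeno.SandwichCluster.Parasite
open Summit.ResolutionOfSingularities.ResolutionOfSingularities.Theorems
open Summit.ResolutionOfSingularities.ResolutionOfSingularities.Theorems.NoZeno
open Literature.AlgebraicGeometry.Resolution
open IsLocalRing Polynomial

variable {k K : Type} [Field k] [Field K] [Algebra k K]

/-! ## The curve-coarsening habitat is closed -/

/-- **E3's CONCLUSION FROM A CURVE COARSENING (PROVED).**  Over E3's working binders (`PersistenceRadical`, `StrictDrop`, the datum, the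
maximality binder, threadlessness, a proper coarsening `≠ K`): if SOME proper coarsening `O < W` has residual transcendence degree `≤ 1`
over `k`, the tower terminates (THM A₂ `TraceSocle.curveCoarsening_terminates`; the escape witness is `hmax W`) and from the regular stage
on there is no `ca`-Zeno chain (`noChain_of_isRegularLocalRing_tower`). [this work; OURS: idea-1 THM A₂] -/
theorem e3Conclusion_of_curveCoarsening (hP : PersistenceRadical) (hD : StrictDrop) (p : ℕ) (hp : p.Prime)
    (k K : Type) [Field k] [CharP k p] [Field K] [Algebra k K] (O : ValuationSubring K) (A : Subalgebra k K)
    (hk : ∀ c : k, algebraMap k K c ∈ O) (hA : A.FG) (hfr : IsFractionRing ↥A K) (hAO : A.toSubring ≤ O.toSubring)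
    (hmax : ∀ O' : ValuationSubring K, O < O' → ∃ m : ℕ, ∃ s ∈ tower O A m, s⁻¹ ∈ O' ∧ s⁻¹ ∉ O)
    (hO₁ : ∃ O₁ : ValuationSubring K, O < O₁ ∧ O₁ ≠ ⊤) (hthr : ¬ SingularPrimeThread O A)
    (W : ValuationSubring K) (hOW : O < W) (hW1 : residueTrdeg k W (fun c => hOW.le (hk c)) ≤ 1) :
    ∃ O₁ : ValuationSubring K, O < O₁ ∧ O₁ ≠ ⊤ ∧ ∃ m₀ : ℕ, ¬ ∃ z : ℕ → K,
      (∀ n : ℕ, (∃ m : ℕ, m₀ ≤ m ∧ z n ∈ ca (tower O A m)) ∧ z n ≠ 0 ∧ (z n)⁻¹ ∈ O₁) ∧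
      (∀ n : ℕ, z n * (z (n + 1))⁻¹ ∈ O) ∧ ∀ n : ℕ, z (n + 1) * (z n)⁻¹ ∉ O := by
  have hkW : ∀ c : k, algebraMap k K c ∈ W := fun c => hOW.le (hk c)
  letI : Algebra k ↥W := algebraOfMem k W hkW
  haveI : IsScalarTower k ↥W K := isScalarTower_algebraOfMem k W hkW
  have hW1' : Algebra.trdeg k (ResidueField ↥W) ≤ 1 := hW1
  obtain ⟨m, hm⟩ := TraceSocle.curveCoarsening_terminates hP hD p hp k K O A hk hA hfr hAO hthr W hOW.le (hmax W hOW) hW1'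
  obtain ⟨O₁, hlt, htop⟩ := hO₁
  exact ⟨O₁, hlt, htop, m, noChain_of_isRegularLocalRing_tower O A hk hA hfr hAO m hm O₁⟩

/-- **In transcendence degree `3`, a proper coarsening that is NOT a prime divisor is a curve coarsening**: `residueTrdeg ≠ 2 ⇒ residueTrdeg = 1`
(hence `≤ 1`), by `coarsening_dvr_or_residueTrdeg_eq_one`'s arithmetic (`1 ≤ F ≤ 2`). [cite: ZariskiSamuel1960, Ch. VI §14, Thm. 31] -/
theorem residueTrdeg_eq_one_of_ne_two (O O₁ : ValuationSubring K) (hk : ∀ c : k, algebraMap k K c ∈ O)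
    (htr : Algebra.trdeg k K = 3) (h : O < O₁) (htop : O₁ ≠ ⊤)
    (hF : residueTrdeg k O₁ (fun c => h.le (hk c)) ≠ 2) : residueTrdeg k O₁ (fun c => h.le (hk c)) = 1 := by
  have hk₁ : ∀ c : k, algebraMap k K c ∈ O₁ := fun c => h.le (hk c)
  have hN : Algebra.trdeg k K < Cardinal.aleph0 := by rw [htr]; exact Cardinal.natCast_lt_aleph0
  obtain ⟨f, hf⟩ := Cardinal.lt_aleph0.mp (residueTrdeg_lt_aleph0 O₁ hk₁ hN)
  obtain ⟨e, he⟩ := Cardinal.lt_aleph0.mp (ratRank_lt_aleph0 O₁ hk₁ hN)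
  have h1 : 1 ≤ f := by have := one_le_residueTrdeg_of_lt O O₁ hk h; rw [hf] at this; exact_mod_cast this
  have he1 : 1 ≤ e := by have := one_le_ratRank_of_ne_top O₁ htop; rw [he] at this; exact_mod_cast this
  have hsum : e + f ≤ 3 := by
    have := ratRank_add_residueTrdeg_le_trdeg O₁ hk₁
    rw [he, hf, htr] at this; exact_mod_cast this
  have hf2 : f ≠ 2 := fun h2 => hF (by rw [hf, h2]; rfl)
  rw [hf]
  have : f = 1 := by omega
  exact_mod_cast this

/-- **A proper coarsening with `residueTrdeg = 2` is a prime divisor, hence a DVR** (tr.deg `3`). [cite: ZariskiSamuel1960, Ch. VI §14, Thm. 31] -/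
theorem isDiscreteValuationRing_of_residueTrdeg_eq_two (O₁ : ValuationSubring K) (hk₁ : ∀ c : k, algebraMap k K c ∈ O₁)
    (hfg : (⊤ : IntermediateField k K).FG) (htr : Algebra.trdeg k K = 3) (htop : O₁ ≠ ⊤)
    (hF : residueTrdeg k O₁ hk₁ = 2) : IsDiscreteValuationRing ↥O₁ := by
  refine isDiscreteValuationRing_of_residueTrdeg O₁ hk₁ hfg htop ?_
  rw [hF, htr]; norm_num


/-! ## TEXT LEVEL: `E3` from `E3^{pd}` — the prime-divisor habitat -/

/-- **`E3` FROM THE PRIME-DIVISOR HABITAT `E3^{pd}`.**  `h` = E3^{pd} := the `E3` text of `…NoZenoCompositeSplit` (binder `h3` of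
`noCaZenoChainSharp_of_split`) with the ground-field binder NAMED (`hk`) and two clauses inserted after the coarsening binder: (nd)
NON-DISCRETE SOCLE — every proper coarsening `U > O` carries an infinite strictly value-decreasing sequence of `U`-units of `O` (else 3-T
`e3Conclusion_of_discreteSocle`); (pd) PRIME DIVISOR — every proper coarsening `O₁ ≠ K` is a discrete valuation ring of residual
transcendence degree `2` (else `residueTrdeg = 1` by the arithmetic and THM A₂ closes the datum: `e3Conclusion_of_curveCoarsening`).  The
conclusion is `E3` verbatim.  So the slot-3 residual of record is {H, E3^{pd}}: «`O = O_E ∘ Ō` on a threefold, `E` a PRIME DIVISOR, `Ō` a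
non-discrete rank-one zero-dimensional valuation of the SURFACE field `κ(E)`; exhausting, threadless ⊢ no `ca`-Zeno chain in the
`E`-units». [this work] -/
theorem noCaZenoChainSharp3_of_primeDivisorSplit
    (h :
      PersistenceRadical → StrictDrop → ∀ p : ℕ, p.Prime → ∀ (k K : Type) [Field k] [CharP k p] [Field K]
        [Algebra k K] (O : ValuationSubring K) (A : Subalgebra k K) (hk : ∀ c : k, algebraMap k K c ∈ O),
        A.FG → IsFractionRing ↥A K → A.toSubring ≤ O.toSubring →
        (∀ O' : ValuationSubring K,
          (∀ m : ℕ, ∀ s ∈ tower O A m, s ∈ O' ∧ (s⁻¹ ∈ O' → s⁻¹ ∈ O)) → ¬ IsNoetherianRing ↥O') →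
        (∀ O' : ValuationSubring K, O < O' → ∃ m : ℕ, ∃ s ∈ tower O A m, s⁻¹ ∈ O' ∧ s⁻¹ ∉ O) →
        (∀ (k' K' : Type) [Field k'] [CharP k' p] [Field K'] [Algebra k' K'] (O' : ValuationSubring K')
          (A' : Subalgebra k' K'), (∀ c : k', algebraMap k' K' c ∈ O') → A'.FG → IsFractionRing ↥A' K' →
          A'.toSubring ≤ O'.toSubring → Algebra.trdeg k' K' < Algebra.trdeg k K →
          ∃ m : ℕ, IsRegularLocalRing ↥(tower O' A' m)) →
        (∀ m : ℕ, ∀ s ∈ tower O A m, ∃ f : Polynomial k, f ≠ 0 ∧ O.valuation (Polynomial.aeval s f) < 1) →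
        Algebra.trdeg k K = 3 →
        (∃ O₁ : ValuationSubring K, O < O₁ ∧ O₁ ≠ ⊤) →
        (∀ U : ValuationSubring K, O < U → ∃ z : ℕ → K, (∀ n : ℕ, z n ∈ O ∧ z n ≠ 0 ∧ (z n)⁻¹ ∈ U) ∧
          (∀ n : ℕ, z n * (z (n + 1))⁻¹ ∈ O) ∧ ∀ n : ℕ, z (n + 1) * (z n)⁻¹ ∉ O) →
        (∀ (O₁ : ValuationSubring K) (h₁ : O < O₁), O₁ ≠ ⊤ →
          IsDiscreteValuationRing ↥O₁ ∧ residueTrdeg k O₁ (fun c => h₁.le (hk c)) = 2) →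
        (∀ x : K, x ∈ O → ∃ m : ℕ, x ∈ tower O A m) →
        ¬ SingularPrimeThread O A →
        ∃ O₁ : ValuationSubring K, O < O₁ ∧ O₁ ≠ ⊤ ∧ ∃ m₀ : ℕ, ¬ ∃ z : ℕ → K,
          (∀ n : ℕ, (∃ m : ℕ, m₀ ≤ m ∧ z n ∈ ca (tower O A m)) ∧ z n ≠ 0 ∧ (z n)⁻¹ ∈ O₁) ∧
          (∀ n : ℕ, z n * (z (n + 1))⁻¹ ∈ O) ∧ ∀ n : ℕ, z (n + 1) * (z n)⁻¹ ∉ O) :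
    PersistenceRadical → StrictDrop → ∀ p : ℕ, p.Prime → ∀ (k K : Type) [Field k] [CharP k p] [Field K]
      [Algebra k K] (O : ValuationSubring K) (A : Subalgebra k K), (∀ c : k, algebraMap k K c ∈ O) →
      A.FG → IsFractionRing ↥A K → A.toSubring ≤ O.toSubring →
      (∀ O' : ValuationSubring K,
        (∀ m : ℕ, ∀ s ∈ tower O A m, s ∈ O' ∧ (s⁻¹ ∈ O' → s⁻¹ ∈ O)) → ¬ IsNoetherianRing ↥O') →
      (∀ O' : ValuationSubring K, O < O' → ∃ m : ℕ, ∃ s ∈ tower O A m, s⁻¹ ∈ O' ∧ s⁻¹ ∉ O) →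
      (∀ (k' K' : Type) [Field k'] [CharP k' p] [Field K'] [Algebra k' K'] (O' : ValuationSubring K')
        (A' : Subalgebra k' K'), (∀ c : k', algebraMap k' K' c ∈ O') → A'.FG → IsFractionRing ↥A' K' →
        A'.toSubring ≤ O'.toSubring → Algebra.trdeg k' K' < Algebra.trdeg k K →
        ∃ m : ℕ, IsRegularLocalRing ↥(tower O' A' m)) →
      (∀ m : ℕ, ∀ s ∈ tower O A m, ∃ f : Polynomial k, f ≠ 0 ∧ O.valuation (Polynomial.aeval s f) < 1) →
      Algebra.trdeg k K = 3 →
      (∃ O₁ : ValuationSubring K, O < O₁ ∧ O₁ ≠ ⊤) →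
      (∀ x : K, x ∈ O → ∃ m : ℕ, x ∈ tower O A m) →
      ¬ SingularPrimeThread O A →
      ∃ O₁ : ValuationSubring K, O < O₁ ∧ O₁ ≠ ⊤ ∧ ∃ m₀ : ℕ, ¬ ∃ z : ℕ → K,
        (∀ n : ℕ, (∃ m : ℕ, m₀ ≤ m ∧ z n ∈ ca (tower O A m)) ∧ z n ≠ 0 ∧ (z n)⁻¹ ∈ O₁) ∧
        (∀ n : ℕ, z n * (z (n + 1))⁻¹ ∈ O) ∧ ∀ n : ℕ, z (n + 1) * (z n)⁻¹ ∉ O := by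
  intro hP hD p hp k K _ _ _ _ O A hk hA hfr hAO hker hmax IH hzd htr hO₁ hexh hthr
  -- the socle dichotomy (3-T)
  by_cases hsocle : ∃ U : ValuationSubring K, O < U ∧ ∀ z : ℕ → K, (∀ n : ℕ, z n ∈ O ∧ z n ≠ 0 ∧ (z n)⁻¹ ∈ U) →
      (∀ n : ℕ, z n * (z (n + 1))⁻¹ ∈ O) → ∃ n : ℕ, z (n + 1) * (z n)⁻¹ ∈ O
  · exact e3Conclusion_of_discreteSocle hP hD p hp k K O A hk hA hfr hAO hmax hO₁ hthr hsocle
  have hnd : ∀ U : ValuationSubring K, O < U → ∃ z : ℕ → K, (∀ n : ℕ, z n ∈ O ∧ z n ≠ 0 ∧ (z n)⁻¹ ∈ U) ∧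
      (∀ n : ℕ, z n * (z (n + 1))⁻¹ ∈ O) ∧ ∀ n : ℕ, z (n + 1) * (z n)⁻¹ ∉ O := by
    intro U hU
    by_contra hno
    push Not at hno
    exact hsocle ⟨U, hU, hno⟩
  haveI := hfr
  haveI : Algebra.FiniteType k ↥A := A.fg_iff_finiteType.mp hA
  have hfg : (⊤ : IntermediateField k K).FG := IntermediateField.fg_top_of_isFractionRing_of_finiteType k ↥A K
  -- the curve-coarsening dichotomy (THM A₂)
  by_cases hcurve : ∃ (W : ValuationSubring K) (hW : O < W), W ≠ ⊤ ∧ residueTrdeg k W (fun c => hW.le (hk c)) ≠ 2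
  · obtain ⟨W, hW, hWtop, hF⟩ := hcurve
    exact e3Conclusion_of_curveCoarsening hP hD p hp k K O A hk hA hfr hAO hmax hO₁ hthr W hW
      (le_of_eq (residueTrdeg_eq_one_of_ne_two O W hk htr hW hWtop hF))
  have hpd : ∀ (O₁ : ValuationSubring K) (h₁ : O < O₁), O₁ ≠ ⊤ →
      IsDiscreteValuationRing ↥O₁ ∧ residueTrdeg k O₁ (fun c => h₁.le (hk c)) = 2 := by
    intro O₁ h₁ htop
    have hF : residueTrdeg k O₁ (fun c => h₁.le (hk c)) = 2 := by
      by_contra hne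
      exact hcurve ⟨O₁, h₁, htop, hne⟩
    exact ⟨isDiscreteValuationRing_of_residueTrdeg_eq_two O₁ _ hfg htr htop hF, hF⟩
  exact h hP hD p hp k K O A hk hA hfr hAO hker hmax IH hzd htr hO₁ hnd hpd hexh hthr

end Summit.ResolutionOfSingularities.ResolutionOfSingularities.Theorems.NoZeno.CompositeSplit

end
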